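import Literature.NumberTheory.GaloisRepresentations.GlobalNormIndexIdelic
import Literature.NumberTheory.GaloisRepresentations.UnramifiedResidueNorm
import Literature.NumberTheory.Automorphic.AdeleRingTopology
import Mathlib.NumberTheory.RamificationInertia.Unramified
import Mathlib.RingTheory.DedekindDomain.Different
import Mathlib.RingTheory.DedekindDomain.Factorization
import HarnessLib

/-!
# The norm on local units above an unramified place is surjective (Childress Prop. 5.7 (iii))

Topic `NumberTheory/GaloisRepresentations` (class field theory: Childress, *Class Field Theory*,
Ch. 4 §5 Lemma 5.3 (a) and Prop. 5.7 (iii), PDF pp. 95, 99); namespace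
`Literature.NumberTheory.GaloisRepresentations.SemiLocal` (continuing `SemiLocalUnits.lean`).
Everything **proved**; this discharges the hypotheses `hun₀`, `hun₁` of
`IdeleClassHerbrand.lean` / `GlobalNormIndexIdelic.lean`.

For a finite Galois extension of number fields `E/F` with group `G` and a finite place `v` of
`F`, in the `G`-algebra `∏_{w ∣ v} E_w` (`SemiLocalUnits.lean`):

* `SemiLocal.exists_unitGroup_norm_eq_of_good` — if `v` is unramified in `E`, the structure
  constants of the normal basis `α_g = g α` of `E/F` are `v`-integral, the `α_g` are integral
  above `v` and `Tr(α)` is a `v`-unit (all true for all but finitely many `v`,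
  `SemiLocal.eventually_good`), then **every `G`-fixed element of `∏_{w∣v} 𝒪_wˣ` is the norm of
  an element of `∏_{w∣v} 𝒪_wˣ`**: a fixed unit is `c ∈ 𝒪_vˣ` (descent); `c ≡ a ∈ 𝓞_F`
  (density); `a ≡ N_{E/F}(β)` with `β` a unit above `v` (`UnramifiedResidueNorm.lean`); and
  `c / N(β) ∈ 1 + 𝔭_v ⊆ N(1 + π·Λ_v)` for the lattice `Λ_v` of the normal basis
  (`NormalBasisCongruence.lean` with the basis scaled once).
* `SemiLocal.exists_finset_local_triviality` — hence there is a finite set `S` of finite places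
  of `F` such that for `v ∉ S` the `G`-module `∏_{w∣v} 𝒪_wˣ` has `Ĥ⁰ = 1` and (by
  `h0_unitGroup_eq_h1`) `Ĥ⁻¹ = 1`, in the element form `hun₀`, `hun₁`.
* `IdeleHerbrand.card_dvd_index_normGroup'` — the idelic first inequality of
  `GlobalNormIndexIdelic.lean` with `hun₀`, `hun₁` discharged (only the units input `hunits`,
  Childress Prop. 5.10, remains a hypothesis).

## References

* N. Childress, *Class Field Theory*, Universitext, Springer 2009, Ch. 4 §5 Lemma 5.3,
  Prop. 5.7 (iii) (PDF pp. 95, 99). [Childress2009]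
-/

noncomputable section

open NumberField IsDedekindDomain
open scoped Valued

namespace Literature.NumberTheory.GaloisRepresentations

namespace SemiLocal

open Literature.NumberTheory.Automorphic NormalBasisCongr

universe u

variable {F : Type u} [Field F] [NumberField F] {E : Type u} [Field E] [NumberField E] [Algebra F E]
variable {v : HeightOneSpectrum (𝓞 F)} [IsGalois F E]

/-! ### The norm lemma of `SemiLocalUnits` with an explicit scaling -/

/-- Variant of `exists_norm_eq_algebraMap_of_norm_sub_one_le` with the scaling exponent `t`
explicit: if the basis scaled by `π^t` has integral structure constants divisible by `π` and
integral members, every `x ∈ F_v` with `|x - 1| ≤ |π^t Tr(α)|` is, as an element of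
`∏_{w∣v} E_w`, the norm of an element of `∏_{w∣v} 𝒪_wˣ`.
[cite: Childress2009, Ch. 4 §5 Lemma 5.3 (PDF p. 95)] -/
theorem exists_norm_eq_algebraMap_of_le {π : v.adicCompletion F} (hπ0 : π ≠ 0) (hπ : ‖π‖ < 1) {t : ℕ}
    (hmul : ∀ g h k : E ≃ₐ[F] E,
      ‖(scaledBasis E hπ0 t).repr (scaledBasis E hπ0 t g * scaledBasis E hπ0 t h) k‖ ≤ ‖π‖)
    (hint : ∀ (g : E ≃ₐ[F] E) (w : Place F E v), Valued.v (scaledBasis E hπ0 t g w) ≤ 1)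
    {x : v.adicCompletion F}
    (hx : ‖x - 1‖ ≤ ‖π ^ t * (Algebra.trace F E (IsGalois.normalBasis F E 1) : v.adicCompletion F)‖) :
    ∃ y ∈ unitGroup F E v, ((Herbrand.norm (E ≃ₐ[F] E) y : (SemiLocal F E v)ˣ) : SemiLocal F E v) =
      algebraMap (v.adicCompletion F) (SemiLocal F E v) x := by
  have hb : ∀ g h : E ≃ₐ[F] E, g • scaledBasis E hπ0 t h = scaledBasis E hπ0 t (g * h) :=
    smul_scaledBasis hπ0 t
  have hVU := congrUnits_le_unitGroup (E := E) hπ0 hπ hmul hint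
  set d : v.adicCompletion F := π ^ t * (Algebra.trace F E (IsGalois.normalBasis F E 1) : v.adicCompletion F)
    with hd
  have hsum : ∑ g : E ≃ₐ[F] E, scaledBasis E hπ0 t g =
      algebraMap (v.adicCompletion F) (SemiLocal F E v) d := by
    simp_rw [scaledBasis_apply]
    rw [← Finset.smul_sum, sum_basis_eq, Algebra.smul_def, ← map_mul]
  have hd0 : d ≠ 0 := by
    refine mul_ne_zero (pow_ne_zero t hπ0) ?_
    intro h
    apply trace_normalBasis_one_ne_zero (F := F) (E := E)
    have hinj : Function.Injective (algebraMap F (v.adicCompletion F)) := (algebraMap F _).injective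
    exact hinj (by rw [map_zero]; exact h)
  set c : v.adicCompletion F := (x - 1) / d with hc
  have hcle : ‖c‖ ≤ ‖π‖ ^ 0 := by
    rw [pow_zero, hc, norm_div, div_le_one (norm_pos_iff.mpr hd0)]
    exact hx
  obtain ⟨y, hy, hNy⟩ := exists_norm_eq_one_add_smul_sum hb hmul hπ hcle
  refine ⟨y, hVU hy, ?_⟩
  rw [hNy, hsum, Algebra.smul_def, ← map_mul, ← map_one (algebraMap (v.adicCompletion F) (SemiLocal F E v)),
    ← map_add]
  congr 1
  rw [hc, div_mul_cancel₀ _ hd0]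
  ring

/-! ### The scaling `t = 1` at a good place -/

/-- With `v`-integral global structure constants, the basis scaled once has structure constants
divisible by `π`. [folklore] -/
theorem hmul_one {π : v.adicCompletion F} (hπ0 : π ≠ 0)
    (hconst : ∀ g h k : E ≃ₐ[F] E, ‖(((IsGalois.normalBasis F E).repr
      (IsGalois.normalBasis F E g * IsGalois.normalBasis F E h) k : F) : v.adicCompletion F)‖ ≤ 1)
    (g h k : E ≃ₐ[F] E) :
    ‖(scaledBasis E hπ0 1).repr (scaledBasis E hπ0 1 g * scaledBasis E hπ0 1 h) k‖ ≤ ‖π‖ := by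
  rw [repr_scaledBasis_mul, pow_one, norm_mul, repr_basis_mul_basis]
  exact mul_le_of_le_one_right (norm_nonneg _) (hconst g h k)

/-- With the `g α` integral above `v`, the basis scaled once (by `|π| ≤ 1`) is integral. [folklore] -/
theorem hint_one {π : v.adicCompletion F} (hπ0 : π ≠ 0) (hπ : ‖π‖ ≤ 1)
    (hα : ∀ (g : E ≃ₐ[F] E) (w : Place F E v),
      Valued.v ((IsGalois.normalBasis F E g : E) : (w : HeightOneSpectrum (𝓞 E)).adicCompletion E) ≤ 1)
    (g : E ≃ₐ[F] E) (w : Place F E v) : Valued.v (scaledBasis E hπ0 1 g w) ≤ 1 := by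
  rw [scaledBasis_apply, pow_one, Pi.smul_apply, Algebra.smul_def, map_mul, basis_apply, diag_apply]
  exact mul_le_one' (valued_algebraMap_le_one hπ w) (hα g w)

/-! ### Fixed units come from `𝒪_vˣ`; norms of diagonal units -/

omit [NumberField F] [IsGalois F E] in
/-- The valuation in `K_v` of a global integer is its integral valuation. [folklore] -/
theorem valued_algebraMap_ringOfIntegers {K : Type*} [Field K] [NumberField K] (u : HeightOneSpectrum (𝓞 K))
    (a : 𝓞 K) : Valued.v (algebraMap (𝓞 K) (u.adicCompletion K) a) = u.intValuation a := by
  rw [show algebraMap (𝓞 K) (u.adicCompletion K) a = ((algebraMap (𝓞 K) K a : K) : u.adicCompletion K) from rfl,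
    HeightOneSpectrum.valuedAdicCompletion_eq_valuation', HeightOneSpectrum.valuation_of_algebraMap]

omit [NumberField F] in
/-- A `G`-fixed element of `∏_{w∣v} 𝒪_wˣ` is `c ∈ 𝒪_vˣ` diagonally. [cite: CasselsFrohlichANT1967, Ch. VII §1.1] -/
theorem exists_eq_algebraMap_of_fixed_unit [NumberField F] {z : (SemiLocal F E v)ˣ} (hz : z ∈ unitGroup F E v)
    (hfix : ∀ σ : E ≃ₐ[F] E, σ • z = z) :
    ∃ c : v.adicCompletion F, Valued.v c = 1 ∧
      algebraMap (v.adicCompletion F) (SemiLocal F E v) c = (z : SemiLocal F E v) := by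
  obtain ⟨c, hc⟩ := exists_eq_algebraMap_of_forall_smul_eq (z : SemiLocal F E v) fun σ => by
    rw [← val_smul_units, hfix σ]
  refine ⟨c, ?_, hc⟩
  obtain ⟨w⟩ := (inferInstance : Nonempty (Place F E v))
  have h1 : Valued.v ((z : SemiLocal F E v) w) = 1 := hz w
  rw [← hc, algebraMap_apply, valued_adicCompletionOfLiesOver] at h1
  exact (IdeleHerbrand.pow_eq_one_iff_of_ne_zero'
    (Ideal.IsDedekindDomain.ramificationIdx'_ne_zero_of_liesOver _ v.ne_bot)).mp h1

/-- The diagonal unit `(β, …, β) ∈ (∏_{w∣v} E_w)ˣ` for `β ≠ 0`. [folklore] -/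
def diagUnit (β : E) (hβ : β ≠ 0) : (SemiLocal F E v)ˣ :=
  ((diag F E v).isUnit_map (isUnit_iff_ne_zero.mpr hβ)).unit

omit [NumberField F] [IsGalois F E] in
/-- Values of `diagUnit`. [folklore] -/
@[simp] theorem val_diagUnit (β : E) (hβ : β ≠ 0) : ((diagUnit β hβ : (SemiLocal F E v)ˣ) : SemiLocal F E v) = diag F E v β :=
  IsUnit.unit_spec _

/-- **`N(β, …, β) = N_{E/F}(β)` diagonally.** [cite: CasselsFrohlichANT1967, Ch. VII §1.1] -/
theorem val_norm_diagUnit (β : E) (hβ : β ≠ 0) :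
    ((Herbrand.norm (E ≃ₐ[F] E) (diagUnit β hβ : (SemiLocal F E v)ˣ) : (SemiLocal F E v)ˣ) : SemiLocal F E v) =
      algebraMap (v.adicCompletion F) (SemiLocal F E v) ((Algebra.norm F β : F) : v.adicCompletion F) := by
  rw [Herbrand.norm_apply, Units.coe_prod]
  simp_rw [val_smul_units, val_diagUnit, smul_diag]
  rw [← map_prod, ← Algebra.norm_eq_prod_automorphisms, diag_algebraMap]

omit [NumberField F] [IsGalois F E] in
/-- `diagUnit β ∈ ∏ 𝒪_wˣ` when `β` is a unit above `v`. [folklore] -/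
theorem diagUnit_mem_unitGroup (β : 𝓞 E) (hβ0 : (β : E) ≠ 0)
    (hβ : ∀ w : HeightOneSpectrum (𝓞 E), w.under (𝓞 F) = v → β ∉ w.asIdeal) :
    diagUnit (β : E) hβ0 ∈ unitGroup F E v := by
  intro w
  rw [val_diagUnit, diag_apply]
  have : ((β : E) : (w : HeightOneSpectrum (𝓞 E)).adicCompletion E) =
      algebraMap (𝓞 E) ((w : HeightOneSpectrum (𝓞 E)).adicCompletion E) β := rfl
  rw [this, valued_algebraMap_ringOfIntegers, HeightOneSpectrum.intValuation_eq_one_iff]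
  exact hβ _ w.under_eq

/-! ### Discrete valuations: `x < 1 ⇒ x ≤ |π|` -/

omit [NumberField F] [IsGalois F E] in
/-- In `ℤₘ₀`, `x < 1` implies `x ≤ exp (-1)`. [folklore] -/
theorem le_exp_neg_one_of_lt_one {x : WithZero (Multiplicative ℤ)} (hx : x < 1) : x ≤ WithZero.exp (-1) := by
  rcases eq_or_ne x 0 with rfl | h0
  · exact zero_le
  · rw [← WithZero.exp_log h0] at hx ⊢
    rw [← WithZero.exp_zero, WithZero.exp_lt_exp] at hx
    rw [WithZero.exp_le_exp]
    omega

/-! ### The main local result -/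

/-- **Childress Prop. 5.7 (iii) / Lemma 5.3 (a), global derivation.**  Let `E/F` be a finite Galois
extension of number fields, `v` a finite place of `F` unramified in `E` such that the structure
constants of the normal basis `(g α)_g` are `v`-integral, the `g α` are integral above `v`, and
`Tr_{E/F}(α)` is a `v`-unit.  Then every `G`-fixed element of `∏_{w∣v} 𝒪_wˣ` is the norm of an
element of `∏_{w∣v} 𝒪_wˣ` (`#Ĥ⁰(G, ∏_{w∣v} 𝒪_wˣ) = 1`).
[cite: Childress2009, Ch. 4 §5 Lemma 5.3 and Prop. 5.7 (iii) (PDF pp. 95, 99)] -/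
theorem exists_unitGroup_norm_eq_of_good (hunr : Algebra.IsUnramifiedIn (𝓞 E) v.asIdeal)
    (hconst : ∀ g h k : E ≃ₐ[F] E, ‖(((IsGalois.normalBasis F E).repr
      (IsGalois.normalBasis F E g * IsGalois.normalBasis F E h) k : F) : v.adicCompletion F)‖ ≤ 1)
    (htr : Valued.v ((Algebra.trace F E (IsGalois.normalBasis F E 1) : F) : v.adicCompletion F) = 1)
    (hα : ∀ (g : E ≃ₐ[F] E) (w : Place F E v),
      Valued.v ((IsGalois.normalBasis F E g : E) : (w : HeightOneSpectrum (𝓞 E)).adicCompletion E) ≤ 1)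
    {z : (SemiLocal F E v)ˣ} (hz : z ∈ unitGroup F E v) (hfix : ∀ σ : E ≃ₐ[F] E, σ • z = z) :
    ∃ y ∈ unitGroup F E v, Herbrand.norm (E ≃ₐ[F] E) y = z := by
  haveI : FiniteDimensional F E := Module.Finite.of_restrictScalars_finite ℚ F E
  -- a global uniformizer
  obtain ⟨ϖ, hϖ⟩ := v.valuation_exists_uniformizer' F
  set π : v.adicCompletion F := ((algebraMap (𝓞 F) F ϖ : F) : v.adicCompletion F) with hπdef
  have hπv : Valued.v π = WithZero.exp (-1) := by
    rw [hπdef, HeightOneSpectrum.valuedAdicCompletion_eq_valuation']; exact hϖ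
  have hπ1 : Valued.v π < 1 := by rw [hπv, ← WithZero.exp_zero, WithZero.exp_lt_exp]; norm_num
  have hπ0 : π ≠ 0 := fun h => by rw [h, map_zero] at hπv; exact WithZero.zero_ne_coe hπv
  have hπ : ‖π‖ < 1 := (Valued.toNormedField.norm_lt_one_iff).mpr hπ1
  -- descent
  obtain ⟨c, hc1, hcz⟩ := exists_eq_algebraMap_of_fixed_unit hz hfix
  -- density: `a ∈ 𝓞 F` with `v(a - c) < v(π)`
  obtain ⟨a, ha⟩ := exists_valued_algebraMap_sub_lt (R := 𝓞 F) (K := F) v (x := c) hc1.le hπ0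
  set A : v.adicCompletion F := algebraMap (𝓞 F) (v.adicCompletion F) a with hAdef
  have ha' : Valued.v (A - c) < Valued.v π := ha
  have hav : Valued.v A = 1 := by
    have : A = c + (A - c) := by ring
    rw [this, Valuation.map_add_eq_of_lt_left]
    · exact hc1
    · rw [hc1]; exact ha'.trans hπ1
  have hanot : a ∉ v.asIdeal := by
    rw [← HeightOneSpectrum.intValuation_eq_one_iff, ← valued_algebraMap_ringOfIntegers v a]
    exact hav
  -- the residue step
  have hunr' : v.asIdeal.ramificationIdxIn (𝓞 E) = 1 := by
    obtain ⟨w⟩ := (inferInstance : Nonempty (Place F E v))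
    haveI : (w : HeightOneSpectrum (𝓞 E)).asIdeal.IsPrime := (w : HeightOneSpectrum (𝓞 E)).isPrime
    rw [Ideal.ramificationIdxIn_eq_ramificationIdx v.asIdeal (w : HeightOneSpectrum (𝓞 E)).asIdeal (E ≃ₐ[F] E)]
    exact hunr.ramificationIdx_eq_one (Place.liesOver w)
  obtain ⟨β, hβunit, hβN⟩ := ResidueNorm.exists_norm_sub_mem (E := E) v hunr' a hanot
  have hβ0 : (β : E) ≠ 0 := by
    obtain ⟨w⟩ := (inferInstance : Nonempty (Place F E v))
    intro h
    apply hβunit _ w.under_eq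
    have : β = 0 := RingOfIntegers.coe_eq_zero_iff.mp h
    rw [this]; exact Submodule.zero_mem _
  -- `N β` as an element of `F_v`
  set Nv : v.adicCompletion F := ((Algebra.norm F (β : E) : F) : v.adicCompletion F) with hNvdef
  have hNvA : Nv = algebraMap (𝓞 F) (v.adicCompletion F) (RingOfIntegers.norm F β) := by
    rw [hNvdef, ← RingOfIntegers.coe_norm]; rfl
  have hNva : Valued.v (Nv - A) ≤ Valued.v π := by
    have hmem : RingOfIntegers.norm F β - a ∈ v.asIdeal := hβN
    rw [hNvA, hAdef, ← map_sub, valued_algebraMap_ringOfIntegers, hπv]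
    exact le_exp_neg_one_of_lt_one ((HeightOneSpectrum.intValuation_lt_one_iff_mem _ _).mpr hmem)
  have hNv1 : Valued.v Nv = 1 := by
    have : Nv = A + (Nv - A) := by ring
    rw [this, Valuation.map_add_eq_of_lt_left]
    · exact hav
    · rw [hav]; exact hNva.trans_lt hπ1
  have hNv0 : Nv ≠ 0 := fun h => by rw [h, map_zero] at hNv1; exact zero_ne_one hNv1
  -- `x = c / N β ∈ 1 + π 𝒪_v`
  set x : v.adicCompletion F := c / Nv with hxdef
  have hx1 : Valued.v (x - 1) ≤ Valued.v π := by
    have : x - 1 = (c - Nv) / Nv := by rw [hxdef, sub_div, div_self hNv0]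
    rw [this, map_div₀, hNv1, div_one]
    have : c - Nv = (c - A) + (A - Nv) := by ring
    rw [this]
    refine (Valuation.map_add _ _ _).trans (max_le ?_ ?_)
    · rw [← Valuation.map_neg, neg_sub]; exact ha'.le
    · rw [← Valuation.map_neg, neg_sub]; exact hNva
  have hx : ‖x - 1‖ ≤ ‖π ^ 1 * (Algebra.trace F E (IsGalois.normalBasis F E 1) : v.adicCompletion F)‖ := by
    rw [Valued.toNormedField.norm_le_iff, pow_one, map_mul, htr, mul_one]
    exact hx1
  obtain ⟨y₁, hy₁, hNy₁⟩ := exists_norm_eq_algebraMap_of_le hπ0 hπ (t := 1) (hmul_one hπ0 hconst)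
    (hint_one hπ0 hπ.le hα) hx
  -- assemble
  refine ⟨diagUnit (β : E) hβ0 * y₁, Subgroup.mul_mem _ (diagUnit_mem_unitGroup β hβ0 hβunit) hy₁, ?_⟩
  apply Units.ext
  rw [map_mul, Units.val_mul, val_norm_diagUnit, hNy₁, ← map_mul, ← hcz]
  congr 1
  rw [hxdef, mul_div_cancel₀ _ hNv0]

/-! ### All but finitely many places are good -/

omit [IsGalois F E] in
/-- Only finitely many places of `F` ramify in `E` (they lie below the prime factors of the
different). [folklore] -/
theorem finite_setOf_not_isUnramifiedIn' :
    {q : HeightOneSpectrum (𝓞 F) | ¬ Algebra.IsUnramifiedIn (𝓞 E) q.asIdeal}.Finite := by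
  have hD : differentIdeal (𝓞 F) (𝓞 E) ≠ ⊥ := differentIdeal_ne_bot
  have hfin : {Q : HeightOneSpectrum (𝓞 E) | Q.asIdeal ∣ differentIdeal (𝓞 F) (𝓞 E)}.Finite :=
    Ideal.finite_factors hD
  refine (hfin.image fun Q => Q.under (𝓞 F)).subset ?_
  intro q hq
  simp only [Set.mem_setOf_eq, Algebra.IsUnramifiedIn, not_forall] at hq
  obtain ⟨Q, hQprime, hQover, hQunr⟩ := hq
  haveI := hQprime
  have hQne : Q ≠ ⊥ := Ideal.ne_bot_of_liesOver_of_ne_bot q.ne_bot Q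
  refine ⟨⟨Q, hQprime, hQne⟩, ?_, ?_⟩
  · exact dvd_differentIdeal_iff.mpr hQunr
  · exact HeightOneSpectrum.ext hQover.over.symm

omit [IsGalois F E] in
/-- A global element is integral at almost all places. [folklore] -/
theorem eventually_valued_coe_le_one (x : F) :
    ∀ᶠ u : HeightOneSpectrum (𝓞 F) in Filter.cofinite, Valued.v (x : u.adicCompletion F) ≤ 1 := by
  have h := (FiniteAdeleRing.algebraMap (𝓞 F) F x).2
  refine h.mono fun u hu => ?_
  exact (HeightOneSpectrum.mem_adicCompletionIntegers _ _ _).mp hu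

omit [IsGalois F E] in
/-- A non-zero global element is a unit at almost all places. [folklore] -/
theorem eventually_valued_coe_eq_one {x : F} (hx : x ≠ 0) :
    ∀ᶠ u : HeightOneSpectrum (𝓞 F) in Filter.cofinite, Valued.v (x : u.adicCompletion F) = 1 := by
  filter_upwards [eventually_valued_coe_le_one x, eventually_valued_coe_le_one x⁻¹] with u h1 h2
  refine le_antisymm h1 ?_
  have hx' : (x : u.adicCompletion F) ≠ 0 := by
    intro h0
    have := HeightOneSpectrum.valuedAdicCompletion_eq_valuation' (v := u) x
    rw [h0, map_zero] at this
    exact (Valuation.ne_zero_iff _).mpr hx this.symm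
  have hprod : Valued.v (x : u.adicCompletion F) * Valued.v ((x⁻¹ : F) : u.adicCompletion F) = 1 := by
    rw [← map_mul]
    have : ((x : u.adicCompletion F)) * ((x⁻¹ : F) : u.adicCompletion F) = 1 := by
      rw [show ((x⁻¹ : F) : u.adicCompletion F) = (x : u.adicCompletion F)⁻¹ from
          map_inv₀ (algebraMap F (u.adicCompletion F)) x, mul_inv_cancel₀ hx']
    rw [this, map_one]
  calc (1 : WithZero (Multiplicative ℤ)) = Valued.v (x : u.adicCompletion F) * Valued.v ((x⁻¹ : F) : u.adicCompletion F) := hprod.symm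
    _ ≤ Valued.v (x : u.adicCompletion F) * 1 := mul_le_mul_right h2 _
    _ = Valued.v (x : u.adicCompletion F) := mul_one _

/-- **All but finitely many finite places of `F` are good**: unramified in `E`, with `v`-integral
structure constants of the normal basis, `v`-unit trace `Tr(α)`, and the `g α` integral above `v`.
[folklore] -/
theorem eventually_good :
    ∀ᶠ v : HeightOneSpectrum (𝓞 F) in Filter.cofinite,
      Algebra.IsUnramifiedIn (𝓞 E) v.asIdeal ∧
      (∀ g h k : E ≃ₐ[F] E, ‖(((IsGalois.normalBasis F E).repr
        (IsGalois.normalBasis F E g * IsGalois.normalBasis F E h) k : F) : v.adicCompletion F)‖ ≤ 1) ∧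
      Valued.v ((Algebra.trace F E (IsGalois.normalBasis F E 1) : F) : v.adicCompletion F) = 1 ∧
      ∀ (g : E ≃ₐ[F] E) (w : Place F E v),
        Valued.v ((IsGalois.normalBasis F E g : E) : (w : HeightOneSpectrum (𝓞 E)).adicCompletion E) ≤ 1 := by
  haveI : FiniteDimensional F E := Module.Finite.of_restrictScalars_finite ℚ F E
  refine Filter.Eventually.and ?_ (Filter.Eventually.and ?_ (Filter.Eventually.and ?_ ?_))
  · exact Filter.eventually_cofinite.mpr finite_setOf_not_isUnramifiedIn'
  · refine Filter.eventually_all.mpr fun g => Filter.eventually_all.mpr fun h => Filter.eventually_all.mpr fun k => ?_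
    filter_upwards [eventually_valued_coe_le_one (F := F)
      ((IsGalois.normalBasis F E).repr (IsGalois.normalBasis F E g * IsGalois.normalBasis F E h) k)] with u hu
    exact Valued.toNormedField.norm_le_one_iff.mpr hu
  · exact eventually_valued_coe_eq_one (trace_normalBasis_one_ne_zero (F := F) (E := E))
  · refine Filter.eventually_all.mpr fun g => ?_
    have hE : {w : HeightOneSpectrum (𝓞 E) |
        ¬ Valued.v ((IsGalois.normalBasis F E g : E) : w.adicCompletion E) ≤ 1}.Finite := by
      have h := (FiniteAdeleRing.algebraMap (𝓞 E) E (IsGalois.normalBasis F E g : E)).2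
      rw [Filter.eventually_cofinite] at h
      refine h.subset fun w hw => ?_
      intro hw'
      exact hw ((HeightOneSpectrum.mem_adicCompletionIntegers _ _ _).mp hw')
    rw [Filter.eventually_cofinite]
    refine (hE.image fun w => w.under (𝓞 F)).subset fun u hu => ?_
    simp only [Set.mem_setOf_eq, not_forall] at hu
    obtain ⟨w, hw⟩ := hu
    exact ⟨(w : HeightOneSpectrum (𝓞 E)), hw, w.under_eq⟩

/-- **Childress Prop. 5.7 (iii) for all places outside a finite set, element form.**  For
`Gal(E/F) = ⟨σ⟩` cyclic there is a finite set `S` of finite places of `F` such that for `v ∉ S`: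
every `G`-fixed element of `∏_{w∣v} 𝒪_wˣ` is a norm from it (`Ĥ⁰ = 1`), and every norm-one
element of it is `σy/y` from it (`Ĥ⁻¹ = 1`, from `Ĥ⁰ = 1` and `#Ĥ⁰ = #Ĥ⁻¹`,
`h0_unitGroup_eq_h1`). [cite: Childress2009, Ch. 4 §5 Prop. 5.7 (iii) (PDF p. 99)] -/
theorem exists_finset_local_triviality {σ : E ≃ₐ[F] E} (hσ : ∀ τ : E ≃ₐ[F] E, τ ∈ Subgroup.zpowers σ) :
    ∃ S : Finset (HeightOneSpectrum (𝓞 F)),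
      (∀ v ∉ S, ∀ z ∈ unitGroup F E v, (∀ g : E ≃ₐ[F] E, g • z = z) →
        ∃ y ∈ unitGroup F E v, Herbrand.norm (E ≃ₐ[F] E) y = z) ∧
      (∀ v ∉ S, ∀ z ∈ unitGroup F E v, Herbrand.norm (E ≃ₐ[F] E) z = 1 →
        ∃ y ∈ unitGroup F E v, Herbrand.twist σ y = z) := by
  have hgood := eventually_good (F := F) (E := E)
  rw [Filter.eventually_cofinite] at hgood
  refine ⟨hgood.toFinset, fun v hv z hz hfix => ?_, fun v hv z hz hN => ?_⟩
  · have hv' := fun h => hv (hgood.mem_toFinset.mpr h)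
    obtain ⟨hunr, hconst, htr, hα⟩ := not_not.mp hv'
    exact exists_unitGroup_norm_eq_of_good hunr hconst htr hα hz hfix
  · have hv' := fun h => hv (hgood.mem_toFinset.mpr h)
    obtain ⟨hunr, hconst, htr, hα⟩ := not_not.mp hv'
    -- `Ĥ⁰ = 1` in index form, hence `Ĥ⁻¹ = 1`
    have h0 : Herbrand.h0 σ (unitGroup F E v) ⊥ = 1 := by
      rw [Herbrand.h0_eq_one_iff]
      intro x hx hfix
      rw [Subgroup.mem_bot, div_eq_one] at hfix
      obtain ⟨y, hy, hyx⟩ := exists_unitGroup_norm_eq_of_good hunr hconst htr hα hx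
        ((Herbrand.forall_smul_eq_iff hσ).mpr hfix)
      rw [Herbrand.b0_bot]
      exact ⟨y, hy, hyx⟩
    have h1 : Herbrand.h1 σ (unitGroup F E v) ⊥ = 1 := by
      rw [← (h0_unitGroup_eq_h1 (F := F) (E := E) (v := v) hσ).1, h0]
    have := (Herbrand.h1_eq_one_iff.mp h1) z hz (by rw [Subgroup.mem_bot]; exact hN)
    rw [Herbrand.b1_bot] at this
    obtain ⟨y, hy, hyz⟩ := this
    exact ⟨y, hy, hyz⟩

end SemiLocal

/-! ### The idelic first inequality with the local input discharged -/

namespace IdeleHerbrand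

open Literature.NumberTheory.Automorphic

universe u

variable {F : Type u} [Field F] [NumberField F] {E : Type u} [Field E] [NumberField E] [Algebra F E]
variable [IsGalois F E] [FiniteDimensional F E]

/-- **The idelic global cyclic norm index (Childress Thm. 5.11 ⇒ first inequality), with
Prop. 5.7 (iii) discharged.**  For a cyclic extension `E/F` of number fields with group `⟨σ⟩` of
order `n`, assuming only Prop. 5.10 for the global units (`hunits`, `hunits'`), the norm group
`Fˣ N_{E/F} J_E ≤ J_F` has finite index divisible by `n`.
[cite: Childress2009, Ch. 4 §5 Thm. 5.11–5.12 (PDF pp. 101–103)] -/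
theorem card_dvd_index_normGroup' {σ : E ≃ₐ[F] E} (hσ : ∀ τ : E ≃ₐ[F] E, τ ∈ Subgroup.zpowers σ)
    (hunits : Fintype.card (E ≃ₐ[F] E) * Herbrand.h0 σ (unitIdeles E ⊓ principalIdeles E) ⊥ =
      ArchHerbrand.archFactor F E * Herbrand.h1 σ (unitIdeles E ⊓ principalIdeles E) ⊥)
    (hunits' : Herbrand.h1 σ (unitIdeles E ⊓ principalIdeles E) ⊥ ≠ 0) :
    Fintype.card (E ≃ₐ[F] E) ∣ (normGroup F E).index ∧ (normGroup F E).index ≠ 0 := by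
  obtain ⟨S, hun₀, hun₁⟩ := SemiLocal.exists_finset_local_triviality (F := F) (E := E) hσ
  exact card_dvd_index_normGroup hσ S hun₀ hun₁ hunits hunits'

end IdeleHerbrand

end Literature.NumberTheory.GaloisRepresentations
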